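import Summits.QuantumFields.YangMills.Theorems.PencilRigidityNPointIsotropyUniversalTwoPointMeasure
import Summits.QuantumFields.YangMills.Theorems.PencilRigidityNPointIsotropyDoubledOrbitKernelDegOne
import HarnessLib

/-!
# `NPointIsotropy` — DEGREE 1 of the analytic input (doubled orbit kernel), unconditionally

Support file for crux `stmt-QuantumFields-11686` (`PencilRigidity.NPointIsotropy`), line `complex-rotation-bandlimit`, lead c2, wave 2:
the composition of `universalTwoPointMeasure` (e₀-reflection positivity + translations + E0' ⇒ ONE tempered positive measure `μ₀` on
`{p₀ ≥ 0}` with `μ_{Ψ_f} = |f̃|² μ₀` for every positive-time one-point `f`; `Theorems/PencilRigidityNPointIsotropyUniversalTwoPointMeasure.lean`)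
and `doubledOrbitKernel_degOne_of_universal` (`μ₀` + the operator cone `H ≥ |P₁|` ⇒ the degree-1 doubled orbit kernel
`K(η', η) = ∫ conj(m_F(η̄', p)) m_F(η, p) dμ₀`, jointly holomorphic on the strip square, type half the temperedness order, uniform in `F`;
`Theorems/PencilRigidityNPointIsotropyDoubledOrbitKernelDegOne.lean`): for EVERY one-species family with an `e₀`-reconstruction, E0' and the
operator cone, the `n = 1` case of the shared analytic stub `stub_doubledOrbitKernel` holds — no kernel hypothesis, no UV bound (the sibling
crux 9663 reaches degree 1 through sharp vectors and the kernel triple of `CurvatureKernelBound`; this route needs neither). [folklore]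
-/

noncomputable section

namespace Summit.QuantumFields.YangMills.Theorems.NPointIsotropy.ComplexRotationBandlimit

open scoped BigOperators InnerProductSpace

/-- **Degree 1 of the doubled orbit kernel, unconditionally** (registered sub-goal `doubledOrbitKernel_degOne` of stmt-QuantumFields-11686):
for a one-species Schwinger family on `ℝ⁴` with an `e₀`-reconstruction `h` (E2 along `e₀` + translations), E0', and joint spectral measures
carried by the planar cone `{p₀ ≥ |p₁|}`, there is a type `Nty` such that every compactly supported time-ordered ONE-point `F` has a rotation
margin `ε` and a doubled orbit kernel `K(η', η) = 𝔖₂(Θ(R_{η'}F)* ⊗ R_η F)` jointly holomorphic on the square of the strip `{|Re z| < ε}` with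
`‖K(θ̄, θ)‖ ≤ C e^{2 Nty |Im θ|}` — pure composition of the two landed wave-2 theorems. [folklore] -/
theorem doubledOrbitKernel_degOne : ∀ (S₁ : Literature.MathematicalPhysics.QuantumLattice.SchwingerFamily (EuclideanSpace ℝ (Fin 4))) (h : Literature.MathematicalPhysics.QuantumFieldTheory.OSReconstructionNoE1 S₁.toLabelled), S₁.toLabelled.HasLinearGrowth → (∀ (ψ : h.Hilbert) (μ : MeasureTheory.Measure (EuclideanSpace ℝ (Fin 4))), h.IsJointSpectralMeasure ψ μ → μ {p : EuclideanSpace ℝ (Fin 4) | p 0 < |p 1|} = 0) → ∃ Nty : ℝ, ∀ (F : SchwartzMap (Fin 1 → EuclideanSpace ℝ (Fin 4)) ℂ), Literature.MathematicalPhysics.QuantumLattice.IsTimeOrdered F → HasCompactSupport (F : (Fin 1 → EuclideanSpace ℝ (Fin 4)) → ℂ) → ∃ ε : ℝ, 0 < ε ∧ (∀ η : ℝ, |η| < ε → Literature.MathematicalPhysics.QuantumLattice.IsTimeOrdered (Literature.MathematicalPhysics.QuantumLattice.linActMulti (Literature.MathematicalPhysics.QuantumFieldTheory.planeRot (0 :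 Fin 3) η) F)) ∧ ∃ (K : ℂ → ℂ → ℂ) (C : ℝ), DifferentiableOn ℂ (Function.uncurry K) ({z : ℂ | |z.re| < ε} ×ˢ {z : ℂ | |z.re| < ε}) ∧ (∀ θ : ℂ, |θ.re| < ε → ‖K (starRingEnd ℂ θ) θ‖ ≤ C * Real.exp (2 * Nty * |θ.im|)) ∧ ∀ η η' : ℝ, |η| < ε → |η'| < ε → ∀ H : SchwartzMap (Fin (1 + 1) → EuclideanSpace ℝ (Fin 4)) ℂ, Literature.MathematicalPhysics.QuantumLattice.IsAppendTensorOf H (Literature.MathematicalPhysics.QuantumLattice.osAdjoint (Literature.MathematicalPhysics.QuantumLattice.linActMulti (Literature.MathematicalPhysics.QuantumFieldTheory.planeRot (0 : Fin 3) η') F)) (Literature.MathematicalPhysics.QuantumLattice.linActMulti (Literature.MathematicalPhysics.QuantumFieldTheory.planeRot (0 : Fin 3) η) F) → K η' η = S₁ (1 + 1) H := by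
  intro S₁ h hlg hcone
  obtain ⟨μ₀, N, hint, hneg, hrep⟩ := universalTwoPointMeasure S₁ h hlg
  exact doubledOrbitKernel_degOne_of_universal S₁ h hlg hcone μ₀ N hint hneg hrep

end Summit.QuantumFields.YangMills.Theorems.NPointIsotropy.ComplexRotationBandlimit

end
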